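import Mathlib
import HarnessLib
import Summits.ResolutionOfSingularities.ResolutionOfSingularities.Theorems.WildQuotientsWildQuotientResolutionS1aKillCentre
import Summits.ResolutionOfSingularities.ResolutionOfSingularities.Theorems.WildQuotientsWildQuotientResolutionS1aOneShotKillChart

/-!
# S1a — PRINCIPAL-KILL CENTRES: the weakest chart-local kill hypothesis the (T2e) consumer chain uses

[OURS · L1 W4.5c · lead-1 g7; FRAME-STATUS rev 3 «caveats»: the consumers of `IsKillCentreChart` only use that the lifted automorphism
of every chart ring has PRINCIPAL augmentation ideal] — NOT statements of the manuscript; counted 0; AI-level work, weaker than expert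
review. Crux stmt-ResolutionOfSingularities-17941, line `s1a-logminvertex` v6, stub `stub_winningStrategy`. DEFINITIONS + projections.

* `IsPrincipalCentreChart p ρ g₀ 𝒦 d O` — `IsCentreChart` data `(B, 𝒜, σ, e; f, δ, w)` such that for EVERY `σ`-invariant cover element
  `b ∈ K d'` (`0 < d'`) the lifted automorphism `sigmaChart` of the chart ring `R^w[(bT^{d'})⁻¹]` has PRINCIPAL augmentation ideal
  (Király–Lütkebohmert-killed along the whole chart). The depth form (`IsKillCentreChart`, via `augmentationIdeal_sigmaChart_eq_span_s`)
  and the shift form (`augmentationIdeal_sigmaChart_eq_span_shift`) are the two known producers.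
* `IsPrincipalCentre p ρ g₀ 𝒦 d` — covered by principal-centre charts and idle charts.
* `isPrincipalCentreChart_of_isKillCentreChart`, `isCentreChart_of_isPrincipalCentreChart`, `isPrincipalCentre_of_isKillCentre`,
  `isAdmissibleCentre_of_isPrincipalCentre`.
-/

set_option linter.dupNamespace false

noncomputable section

open CategoryTheory AlgebraicGeometry TopologicalSpace
open Literature.AlgebraicGeometry.Resolution Literature.AlgebraicGeometry.RelativeSpec
open Summit.ResolutionOfSingularities.ResolutionOfSingularities.Theorems.WildQuotientResolution.S1
open Summit.ResolutionOfSingularities.ResolutionOfSingularities.Theorems.WildQuotientResolution.S1.ProducerStep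
open Summit.ResolutionOfSingularities.ResolutionOfSingularities.Theorems.WildQuotientResolution.S1.CoarseChart

namespace Summit.ResolutionOfSingularities.ResolutionOfSingularities.Theorems.WildQuotientResolution.S1.NodeAtlas

universe u

section Centre

variable (p : ℕ) {V Y : Scheme.{u}} {q : V ⟶ Y} {G : Type*} [Group G] (ρ : ActionOver q G) (g₀ : G)

/-- **PRINCIPAL-centre chart**: the centre data of `IsCentreChart` whose weighted blow-up is KILLED on every `σ`-invariant chart: for all
`σ`-invariant `b ∈ K d'`, `0 < d'`, the lifted automorphism `sigmaChart` of `R^w[(bT^{d'})⁻¹]` has principal augmentation ideal.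
[OURS · L1 W4.5c] -/
def IsPrincipalCentreChart (𝒦 : ReesFiltration V) (d : ℕ) (O : ρ.StableAffineOpens) : Prop :=
  ∃ (hO : IsAffineOpen O.1) (m : ℕ) (r : Fin m → ℕ) (B : Type u) (_ : CommRing B)
    (𝒜 : (Π j : Fin m, ZMod (r j)) → AddSubgroup B) (_ : GradedRing 𝒜) (σ : B ≃+* B)
    (e : Γ(V, O.1) ≃+* ↥(𝒜 0)),
    IsTameNode p B 𝒜 σ ∧
    (∀ t : Γ(V, O.1),
      ((e ((ρ.aut g₀⁻¹).hom.appLE O.1 O.1 (O.2.1 g₀⁻¹).ge t) : ↥(𝒜 0)) : B) = σ ((e t : ↥(𝒜 0)) : B)) ∧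
    ∃ (c : ℕ) (f : Fin c → B) (δ : Fin c → Π j : Fin m, ZMod (r j)) (w : Fin c → ℕ),
      0 < c ∧ (∀ i, f i ∈ 𝒜 (δ i)) ∧ (∀ i, 0 < w i) ∧
      RingTheory.Sequence.IsRegular B (List.ofFn f) ∧ IsRegularRing (B ⧸ Ideal.span (Set.range f)) ∧
      ∃ (hσJ : ∀ n : ℕ, ((weightedFiltration f w).ideal n).map (σ : B →+* B) ≤ (weightedFiltration f w).ideal n),
      (∀ n : ℕ, (𝒦.filtration ⟨O.1, hO⟩).ideal n =
        ((CoarseChart.traceFiltration 𝒜 f w).ideal n).comap (e : Γ(V, O.1) →+* ↥(𝒜 0))) ∧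
      CoarseChart.VeroneseNormalised 𝒜 f w d ∧
      -- the KILL, in its weakest consumable form
      ∀ (hp : 0 < p) (hσp : ∀ x : B, (⇑σ)^[p] x = x) (d' : ℕ) (b : ↥(𝒜 0))
        (hb : b ∈ (CoarseChart.traceFiltration 𝒜 f w).ideal d') (hσb : σ (b : B) = b), 0 < d' →
        (augmentationIdeal (CoarseChart.sigmaChart 𝒜 f w d' b hb σ hσJ hp hσp hσb)).IsPrincipal

/-- **PRINCIPAL centre** with Veronese degree `d`: a `G`-STABLE Rees filtration covered by principal-centre charts and idle charts.
[OURS · L1 W4.5c] -/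
def IsPrincipalCentre (𝒦 : ReesFiltration V) (d : ℕ) : Prop :=
  0 < d ∧ (∀ (g : G) (n : ℕ), (𝒦.ideal n).comap (ρ.aut g).hom = 𝒦.ideal n) ∧
    ∀ v : V, ∃ O : ρ.StableAffineOpens, v ∈ O.1 ∧ (IsPrincipalCentreChart p ρ g₀ 𝒦 d O ∨ IsIdleChart p ρ g₀ 𝒦 O)

variable {p ρ g₀}

/-- A principal-centre chart is a centre chart. -/
theorem isCentreChart_of_isPrincipalCentreChart {𝒦 : ReesFiltration V} {d : ℕ} {O : ρ.StableAffineOpens}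
    (h : IsPrincipalCentreChart p ρ g₀ 𝒦 d O) : IsCentreChart p ρ g₀ 𝒦 d O := by
  obtain ⟨hO, m, r, B, _, 𝒜, _, σ, e, hnode, hσ, c, f, δ, w, hc, hf, hw, hK1, hK1', hσJ, h𝒦, hver, -⟩ := h
  exact ⟨hO, m, r, B, inferInstance, 𝒜, inferInstance, σ, e, hnode, hσ, c, f, δ, w, hc, hf, hw, hK1, hK1', hσJ, h𝒦, hver⟩

/-- **The depth-form kill centre is a principal centre** (`augmentationIdeal_sigmaChart_eq_span_s`). -/
theorem isPrincipalCentreChart_of_isKillCentreChart {𝒦 : ReesFiltration V} {d : ℕ} {O : ρ.StableAffineOpens}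
    (h : IsKillCentreChart p ρ g₀ 𝒦 d O) : IsPrincipalCentreChart p ρ g₀ 𝒦 d O := by
  obtain ⟨hO, m, r, B, _, 𝒜, _, σ, e, hnode, hσ, c, f, δ, w, hc, hf, hw, hK1, hK1', hσJ, h𝒦, hver, hfI, h1, hdepth, hD2⟩ := h
  refine ⟨hO, m, r, B, inferInstance, 𝒜, inferInstance, σ, e, hnode, hσ, c, f, δ, w, hc, hf, hw, hK1, hK1', hσJ, h𝒦, hver, ?_⟩
  intro hp hσp d' b hb hσb hd'
  exact ⟨⟨_, OneShotKill.augmentationIdeal_sigmaChart_eq_span_s 𝒜 f w d' b hb σ hσJ hp hσp hσb hw hd' hfI h1 hdepth hD2⟩⟩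

/-- A kill centre is a principal centre. -/
theorem isPrincipalCentre_of_isKillCentre {𝒦 : ReesFiltration V} {d : ℕ} (h : IsKillCentre p ρ g₀ 𝒦 d) :
    IsPrincipalCentre p ρ g₀ 𝒦 d :=
  ⟨h.1, h.2.1, fun v => (h.2.2 v).imp fun _ hO => ⟨hO.1, hO.2.imp_left isPrincipalCentreChart_of_isKillCentreChart⟩⟩

/-- A principal centre is an admissible centre. -/
theorem isAdmissibleCentre_of_isPrincipalCentre {𝒦 : ReesFiltration V} {d : ℕ} (h : IsPrincipalCentre p ρ g₀ 𝒦 d) :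
    IsAdmissibleCentre p ρ g₀ 𝒦 d :=
  ⟨h.1, h.2.1, fun v => (h.2.2 v).imp fun _ hO => ⟨hO.1, hO.2.imp_left isCentreChart_of_isPrincipalCentreChart⟩⟩

end Centre

end Summit.ResolutionOfSingularities.ResolutionOfSingularities.Theorems.WildQuotientResolution.S1.NodeAtlas

end
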